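import Summits.CriticalPhenomena.SAWScalingLimit.Theorems.SAWLoopFugacityFlowAvoidanceLimitAnchorDefs
import Summits.CriticalPhenomena.SAWScalingLimit.Theorems.SAWLoopFugacityFlowAvoidanceLimitSawEndpoint
import Literature.Probability.LatticeModels.DiluteLoopModelAnalyticity
import Literature.Probability.RandomPlanarGeometry.SupercriticalSAWPolygons

/-!
# The critical curve of line `saw-corner-germ` is well posed — helper of stub
`stub_positiveFugacityLimits` (crux `SAWLoopFugacityFlow.AvoidanceLimit`, stmt-CriticalPhenomena-10649)

The line `saw-corner-germ` (skeleton `Cruxes/AvoidanceLimit/Lines/saw_corner_germ.lean`) runs the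
loop-fugacity continuation of the doubly normalised two-leg ratio `R_δ(n; D, D')` of the strictly
dilute loop-dressed SAW (the `t = 0` slice `dimerPF n 0 x` of the Anchor objects) ALONG THE CRITICAL
CURVE `critLine n := sSup {x ∈ [0, 1] | ∀ y ∈ [0, x], IsMassive n y}`, where `IsMassive n y` says that
the corner-to-corner two-leg function of the lattice square `[0, k]²`,
`boxTwoLeg k n y = twoLegDim n 0 y ℤ² [0,k]² 0 (k,k)`, is `≤ e^{-mk}` eventually.

This file records, in tree vocabulary (no import of the skeleton), the facts that make this
convention junk-free for EVERY loop fugacity `n`: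

* `dimerPF_fugacity_zero_of_nonempty`, `twoLegDim_fugacity_zero_of_ne`: at edge fugacity `x = 0`
  the two-leg partition function with a non-empty source set vanishes (every admissible edge set is
  non-empty and carries the factor `0^{|F|}`), while the source-free one is `1`
  (`DiluteLoopModel.partitionFunction_fugacity_zero`), so the normalised two-leg function between
  distinct points is `0`;
* `isMassive_zero` (the registered helper): hence `(n, 0)` is massive for every `n` — the set whose
  supremum defines `critLine n` contains `0`;
* `critLineSet_nonempty`, `critLineSet_bddAbove`, `critLine_mem_Icc` (registered): that set is
  non-empty and bounded by `1`, so `critLine n ∈ [0, 1]` is an honest supremum (no `sSup ∅` /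
  `sSup` of an unbounded set junk);
* `twoLegDim_dimerFugacity_zero_nonneg`, `twoLegDim_dimerFugacity_zero_pos`,
  `ratio_dimerFugacity_zero_nonneg`, `twoLegDim_discreteDomain_pos` (the last two registered): for
  `n ≥ 0`, `x ≥ 0` the `t = 0` two-leg functions are honest nonnegative quotients (the source-free
  partition functions are `≥ 1`, tree `DiluteLoopModel.one_le_partitionFunction_empty`), the route's
  ratio `R_δ(n, 0, x)` is nonnegative, and its denominator — the two-leg function of `Ω_δ` — is
  positive as soon as `x > 0` and the two legs `a ≠ b` are joined in `Ω_δ` (which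
  `SAW.IsEndpointApprox.reachable` supplies eventually in `δ`).

Sources: W. Guo, H. Blöte, B. Nienhuis, Int. J. Mod. Phys. C 10 (1999) 301, §1 eq. (1), §2
[GuoBloteNienhuis1999]; N. Madras, G. Slade, *The Self-Avoiding Walk* (1993), §1.2 [MadrasSlade1993].
No statement of the line is asserted here.
-/

noncomputable section

open Set Filter Topology
open scoped BigOperators symmDiff
open Literature.Probability.RandomPlanarGeometry Literature.Probability.LatticeModels
open Summit.CriticalPhenomena.SAWScalingLimit.Theorems.AvoidanceLimit.Anchor

namespace Summit.CriticalPhenomena.SAWScalingLimit.Theorems.AvoidanceLimit.Corner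

/-! ## Edge fugacity `x = 0`: the two-leg function between distinct points vanishes -/

section FugacityZero

variable {K : Type*} [Field K] {G : SimpleGraph (Site 2)} [G.LocallyFinite]

/-- An admissible edge set with a NON-EMPTY source set is non-empty (the empty edge set has no
odd vertex). [folklore] -/
theorem nonempty_of_mem_configs {Λ A : Finset (Site 2)} (hA : A.Nonempty) {F : Finset (Sym2 (Site 2))}
    (hF : F ∈ DiluteLoopModel.configs G Λ A) : F.Nonempty := by
  rw [Finset.nonempty_iff_ne_empty]
  rintro rfl
  rw [DiluteLoopModel.mem_configs] at hF
  obtain ⟨-, hodd⟩ := hF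
  have : A = ∅ := by
    rw [← hodd]
    refine Finset.filter_eq_empty_iff.2 fun v _ => ?_
    simp
  exact hA.ne_empty this

/-- **`Z_{n,w,0}(G, Λ; A) = 0` for a non-empty source set `A`**: every admissible edge set is
non-empty and its weight carries the factor `0^{|F|} = 0`. [cite: GuoBloteNienhuis1999, §1 eq. (1)] -/
theorem partitionFunction_fugacity_zero_of_nonempty {R : Type*} [CommSemiring R] (n w : R)
    {Λ A : Finset (Site 2)} (hA : A.Nonempty) :
    (⟨n, w, 0⟩ : DiluteLoopModel R).partitionFunction G Λ A = 0 := by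
  rw [DiluteLoopModel.partitionFunction]
  refine Finset.sum_eq_zero fun F hF => Finset.sum_eq_zero fun S _ => ?_
  have hne : Finset.card F ≠ 0 := Finset.card_ne_zero.2 (nonempty_of_mem_configs hA hF)
  simp [DiluteLoopModel.weight, zero_pow hne]

/-- At edge fugacity `0` the dressed two-leg partition function with a non-empty source set
vanishes (any dimer fugacity `t`: the dimer factor is `(t · 0²)^{|M|}`, and every inner loop-model
factor is `Z_{n,0,0}(·; A) = 0`). [cite: GuoBloteNienhuis1999, §1 eq. (1)] -/
theorem dimerPF_fugacity_zero_of_nonempty (n t : K) {Λ A : Finset (Site 2)} (hA : A.Nonempty) :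
    dimerPF n t 0 G Λ A = 0 := by
  rw [dimerPF]
  refine Finset.sum_eq_zero fun M _ => ?_
  rw [partitionFunction_fugacity_zero_of_nonempty n 0 hA, mul_zero]

/-- **At edge fugacity `0` the normalised two-leg function between DISTINCT points is `0`** (for
every loop fugacity `n` and dimer fugacity `t`; numerator `0`). [cite: GuoBloteNienhuis1999, §2 (Z'/Z)] -/
theorem twoLegDim_fugacity_zero_of_ne (n t : K) (Λ : Finset (Site 2)) {a b : Site 2} (hab : a ≠ b) :
    twoLegDim n t 0 G Λ a b = 0 := by
  have hA : (({a} : Finset (Site 2)) ∆ {b}).Nonempty :=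
    ⟨a, Finset.mem_symmDiff.2 (Or.inl ⟨Finset.mem_singleton_self a, by simpa using hab⟩)⟩
  rw [twoLegDim, dimerPF_fugacity_zero_of_nonempty n t hA, zero_div]

end FugacityZero

/-! ## The registered helper: `(n, 0)` is massive for every `n` -/

/-- The diagonal corner `(k, k)` of the square `[0, k]²` differs from the corner `0` once `k ≠ 0`.
[cite: DuminilCopinKozmaYadin2014, §2 (squared walks)] -/
theorem diag_ne_zero {k : ℕ} (hk : k ≠ 0) : SAW.diag k ≠ 0 := by
  intro h
  have := congr_fun h 0
  simp only [SAW.diag, Pi.zero_apply, Nat.cast_eq_zero] at this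
  exact hk this

/-- **`IsMassive n 0` for every loop fugacity `n`** (helper `isMassive_zero` of stub
`stub_positiveFugacityLimits`, line `saw-corner-germ`, UNFOLDED into tree vocabulary): at edge
fugacity `0` the corner-to-corner two-leg function of the strictly dilute loop-dressed SAW across
`[0, k]²` is `0` for every `k ≥ 1` (`twoLegDim_fugacity_zero_of_ne`), hence `≤ e^{-mk}` eventually,
for `m = 1` say. Consequently the set `{x ∈ [0,1] | ∀ y ∈ [0,x], IsMassive n y}` whose supremum is
the line's critical curve `critLine n` contains `0`. [cite: GuoBloteNienhuis1999, §2 (Z'/Z)] -/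
theorem isMassive_zero :
    ∀ n : ℝ, ∃ m : ℝ, 0 < m ∧ ∀ᶠ k : ℕ in atTop,
      twoLegDim n 0 0 (zdGraph 2) ((box 2 k).filter fun v => ∀ i, 0 ≤ v i) 0 (SAW.diag k) ≤
        Real.exp (-(m * k)) := by
  intro n
  refine ⟨1, one_pos, ?_⟩
  filter_upwards [eventually_ne_atTop 0] with k hk
  rw [twoLegDim_fugacity_zero_of_ne n 0 _ (diag_ne_zero hk).symm]
  exact (Real.exp_pos _).le

/-! ## The supremum defining `critLine n` is honest -/

/-- The set whose supremum is the line's `critLine n` (UNFOLDED: `x ∈ [0, 1]` such that every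
`y ∈ [0, x]` is massive for the corner-to-corner two-leg function of `[0, k]²`) contains `0`.
[cite: GuoBloteNienhuis1999, §2 (Z'/Z)] -/
theorem zero_mem_critLineSet (n : ℝ) :
    (0 : ℝ) ∈ {x : ℝ | 0 ≤ x ∧ x ≤ 1 ∧ ∀ y ∈ Set.Icc 0 x, ∃ m : ℝ, 0 < m ∧ ∀ᶠ k : ℕ in atTop,
      twoLegDim n 0 y (zdGraph 2) ((box 2 k).filter fun v => ∀ i, 0 ≤ v i) 0 (SAW.diag k) ≤
        Real.exp (-(m * k))} := by
  refine ⟨le_rfl, zero_le_one, fun y hy => ?_⟩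
  obtain rfl : y = 0 := le_antisymm hy.2 hy.1
  exact isMassive_zero n

/-- That set is non-empty. [cite: GuoBloteNienhuis1999, §2 (Z'/Z)] -/
theorem critLineSet_nonempty (n : ℝ) :
    {x : ℝ | 0 ≤ x ∧ x ≤ 1 ∧ ∀ y ∈ Set.Icc 0 x, ∃ m : ℝ, 0 < m ∧ ∀ᶠ k : ℕ in atTop,
      twoLegDim n 0 y (zdGraph 2) ((box 2 k).filter fun v => ∀ i, 0 ≤ v i) 0 (SAW.diag k) ≤
        Real.exp (-(m * k))}.Nonempty :=
  ⟨0, zero_mem_critLineSet n⟩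

/-- That set is bounded above by `1` (the cap in the definition of `critLine`). [folklore] -/
theorem critLineSet_bddAbove (n : ℝ) :
    BddAbove {x : ℝ | 0 ≤ x ∧ x ≤ 1 ∧ ∀ y ∈ Set.Icc 0 x, ∃ m : ℝ, 0 < m ∧ ∀ᶠ k : ℕ in atTop,
      twoLegDim n 0 y (zdGraph 2) ((box 2 k).filter fun v => ∀ i, 0 ≤ v i) 0 (SAW.diag k) ≤
        Real.exp (-(m * k))} :=
  ⟨1, fun _ hx => hx.2.1⟩

/-- **`critLine n ∈ [0, 1]` for every `n`** (UNFOLDED): the supremum of a non-empty subset of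
`[0, 1]` containing `0`. [folklore] -/
theorem critLine_mem_Icc :
    ∀ n : ℝ, sSup {x : ℝ | 0 ≤ x ∧ x ≤ 1 ∧ ∀ y ∈ Set.Icc 0 x, ∃ m : ℝ, 0 < m ∧ ∀ᶠ k : ℕ in atTop,
      twoLegDim n 0 y (zdGraph 2) ((box 2 k).filter fun v => ∀ i, 0 ≤ v i) 0 (SAW.diag k) ≤
        Real.exp (-(m * k))} ∈ Set.Icc (0 : ℝ) 1 := fun n =>
  ⟨le_csSup (critLineSet_bddAbove n) (zero_mem_critLineSet n),
    csSup_le (critLineSet_nonempty n) fun _ hx => hx.2.1⟩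

/-! ## The `t = 0` two-leg functions and the ratio `R_δ(n, 0, x)` are honest quotients for `n, x ≥ 0` -/

section Positivity

variable {G : SimpleGraph (Site 2)} [G.LocallyFinite]

/-- For `n, x ≥ 0` the `t = 0` dressed partition functions are nonnegative. [cite: GuoBloteNienhuis1999, §1 eq. (1)] -/
theorem dimerPF_dimerFugacity_zero_nonneg {n x : ℝ} (hn : 0 ≤ n) (hx : 0 ≤ x) (Λ A : Finset (Site 2)) :
    0 ≤ dimerPF n 0 x G Λ A := by
  rw [dimerPF_dimerFugacity_zero]
  exact DiluteLoopModel.partitionFunction_nonneg (L := ⟨n, 0, x⟩) hn le_rfl hx Λ A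

/-- For `n, x ≥ 0` the `t = 0` normalised two-leg function is nonnegative. [cite: GuoBloteNienhuis1999, §2 (Z'/Z)] -/
theorem twoLegDim_dimerFugacity_zero_nonneg {n x : ℝ} (hn : 0 ≤ n) (hx : 0 ≤ x) (Λ : Finset (Site 2))
    (a b : Site 2) : 0 ≤ twoLegDim n 0 x G Λ a b :=
  div_nonneg (dimerPF_dimerFugacity_zero_nonneg hn hx Λ _) (dimerPF_dimerFugacity_zero_nonneg hn hx Λ _)

/-- **For `n ≥ 0`, `x > 0` the `t = 0` normalised two-leg function is POSITIVE** on a subgraph of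
`ℤ²` as soon as a self-avoiding path from `a` to `b ≠ a` inside `Λ` exists (its edge set is an
admissible collision-free loop-free configuration of weight `x^{|γ|} > 0`; the denominator is `≥ 1`).
[cite: GuoBloteNienhuis1999, §2 (Z'/Z)] -/
theorem twoLegDim_dimerFugacity_zero_pos (hG : G ≤ zdGraph 2) {n x : ℝ} (hn : 0 ≤ n) (hx : 0 < x)
    {Λ : Finset (Site 2)} {a b : Site 2} (hab : a ≠ b) {p : G.Walk a b} (hp : p.IsPath)
    (hΛ : ∀ v ∈ p.support, v ∈ Λ) : 0 < twoLegDim n 0 x G Λ a b := by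
  rw [twoLegDim_dimerFugacity_zero]
  exact DiluteLoopModel.twoLeg_pos_of_path hG (L := ⟨n, 0, x⟩) hn le_rfl hx hab hp hΛ

/-- **The route's ratio `R_δ(n, 0, x; Ω, S)` is nonnegative for `n, x ≥ 0`** (a quotient of two
nonnegative two-leg functions; Lean's `y / 0 = 0` in the junk case of no SAW from `a` to `b` in
`Ω_δ`). [cite: GuoBloteNienhuis1999, §2] -/
theorem ratio_dimerFugacity_zero_nonneg :
    ∀ (n x : ℝ), 0 ≤ n → 0 ≤ x → ∀ (Ω S : Set ℂ) (δ : ℝ) (a b : Site 2), 0 ≤ Rδ n 0 x Ω S δ a b :=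
  fun _ _ hn hx _ _ _ a b =>
    div_nonneg (twoLegDim_dimerFugacity_zero_nonneg hn hx _ a b)
      (twoLegDim_dimerFugacity_zero_nonneg hn hx _ a b)

/-- **The denominator of `R_δ(n, 0, x; Ω, S)` is positive** for `n ≥ 0`, `x > 0` as soon as
`a ≠ b` are joined by a walk of `Ω_δ` (bounded `Ω`, `δ > 0`): the two-leg function of `Ω_δ` in the
volume `meshDomainFinset Ω δ` is `> 0`, so the ratio is an honest quotient there.
[cite: GuoBloteNienhuis1999, §2 (Z'/Z)] -/
theorem twoLegDim_discreteDomain_pos :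
    ∀ (Ω : Set ℂ), Bornology.IsBounded Ω → ∀ (δ : ℝ), 0 < δ → ∀ (n x : ℝ), 0 ≤ n → 0 < x →
      ∀ (a b : Site 2), a ≠ b → (discreteDomainGraph Ω δ).Reachable a b →
        0 < twoLegDim n 0 x (discreteDomainGraph Ω δ) (meshDomainFinset Ω δ) a b := by
  classical
  intro Ω hΩ δ hδ n x hn hx a b hab hreach
  obtain ⟨w⟩ := hreach
  -- `a` is a vertex of `Ω_δ`: the first edge of the (non-trivial) walk starts in `meshDomain Ω δ`
  have ha : a ∈ meshDomain Ω δ := by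
    obtain ⟨c, hac, -, -⟩ := w.exists_eq_cons_of_ne hab
    exact (discreteDomainGraph_adj_iff.1 hac).2.1
  have hp : w.bypass.IsPath := w.bypass_isPath
  refine twoLegDim_dimerFugacity_zero_pos
    ((discreteDomainGraph_le_meshGraph Ω δ).trans (meshGraph_le_zdGraph Ω δ)) hn hx hab hp ?_
  intro v hv
  rw [← Finset.mem_coe, coe_meshDomainFinset hΩ hδ]
  exact DiluteLoopModel.support_subset_meshDomain w.bypass ha v hv

end Positivity

end Summit.CriticalPhenomena.SAWScalingLimit.Theorems.AvoidanceLimit.Corner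

end
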